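import Summits.AtomisticToContinuum.HydrodynamicLimit.Theses.RelayRaceLocality
import Literature.Analysis.FunctionSpaces.TorusSpaceTime
import Literature.Analysis.FunctionSpaces.TorusSpaceTimeComposition
import HarnessLib

/-!
# Crux `RestartPrinciple` (stmt-AtomisticToContinuum-12503), line `Sketch` — stub `stub_finiteSize`

Support file for the crux `Summit.AtomisticToContinuum.HydrodynamicLimit.Theses.RelayRaceLocality.RestartPrinciple`
(route `RelayRaceLocality`), line `Sketch`: the ELEMENTARY finite-size stub of the restart
induction. A classical hard-sphere Euler solution `IsHardSphereEulerSolution σ T ρ u θ` has, on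
every `[0, t] ⊂ [0, T)`, bounded `ρ, θ, ‖u‖`, temperature bounded below, and bounded spatial
`Torus.partialDeriv`'s of `(ρ, u, θ)` up to order `3`, all by ONE level `M = M(t) > 0` (the guard
level fed to the restartable short-time hydrodynamic limit).

Proof: joint smoothness on `Ico 0 T × 𝕋³` (`Torus.IsSmoothSpaceTimeOn`) is inherited by every
spatial partial derivative (`Torus.IsSmoothSpaceTimeOn.partialDeriv`, `uniqueDiffOn_Ico`) and by
`θ⁻¹` (`Torus.IsSmoothSpaceTimeOn.comp_contDiffOn` with `Inv.inv` on `{0}ᶜ`, `θ > 0`); each such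
field is bounded on the compact `Icc 0 t ⊆ Ico 0 T` (`Torus.IsSmoothSpaceTimeOn.exists_norm_le_of_isCompact`).
The finitely many bounds (indices in `Fin 3`) are merged through the `atTop` filter on `ℝ`
(`Filter.eventually_all`): "bounded by `C`" holds for all large `C`.
-/

-- header kept identical to the registered line skeleton `Cruxes/RestartPrinciple/Lines/Sketch.lean`,
-- which re-imports this stub into the same namespace (lead's brief)
set_option linter.dupNamespace false

noncomputable section

open Literature.MathematicalPhysics.KineticTheory Literature.Analysis.FluidPDE
open Literature.Analysis.FunctionSpaces MeasureTheory Filter Set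
open Summit.AtomisticToContinuum.HydrodynamicLimit.Theses.RelayRaceLocality

namespace Summit.AtomisticToContinuum.HydrodynamicLimit.Theorems.RestartPrinciple

/-- A jointly smooth field on `S × 𝕋³` is bounded on `K × 𝕋³`, `K ⊆ S` compact, by every
sufficiently large constant: `∀ᶠ C in atTop, ∀ s ∈ K, ∀ x, ‖f s x‖ ≤ C`
(`Torus.IsSmoothSpaceTimeOn.exists_norm_le_of_isCompact`, monotonicity in `C`). [folklore] -/
private theorem eventually_norm_le {F : Type*} [NormedAddCommGroup F] [NormedSpace ℝ F]
    {S K : Set ℝ} {f : ℝ → T3 → F} (hf : Torus.IsSmoothSpaceTimeOn S f) (hK : IsCompact K)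
    (hKS : K ⊆ S) : ∀ᶠ C in atTop, ∀ s ∈ K, ∀ x, ‖f s x‖ ≤ C := by
  obtain ⟨C, hC⟩ := hf.exists_norm_le_of_isCompact hK hKS
  filter_upwards [eventually_ge_atTop C] with C' hC' s hs x using (hC s hs x).trans hC'

/-- A jointly smooth field on `S × 𝕋³` (`S` a time set of unique differentiability) and its
spatial partial derivatives of orders `1, 2, 3` are bounded on `K × 𝕋³`, `K ⊆ S` compact, by
every sufficiently large constant (iterate `Torus.IsSmoothSpaceTimeOn.partialDeriv`; finitely
many indices, `Filter.eventually_all`). [folklore] -/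
private theorem eventually_derivs_le {F : Type*} [NormedAddCommGroup F] [NormedSpace ℝ F]
    {S K : Set ℝ} {f : ℝ → T3 → F} (hf : Torus.IsSmoothSpaceTimeOn S f) (hS : UniqueDiffOn ℝ S)
    (hK : IsCompact K) (hKS : K ⊆ S) :
    ∀ᶠ C in atTop, ∀ s ∈ K, ∀ x, ‖f s x‖ ≤ C ∧ ∀ i j k : Fin 3,
      ‖Torus.partialDeriv i (f s) x‖ ≤ C ∧
      ‖Torus.partialDeriv i (Torus.partialDeriv j (f s)) x‖ ≤ C ∧
      ‖Torus.partialDeriv i (Torus.partialDeriv j (Torus.partialDeriv k (f s))) x‖ ≤ C := by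
  have h0 := eventually_norm_le hf hK hKS
  have h1 : ∀ᶠ C in atTop, ∀ i : Fin 3, ∀ s ∈ K, ∀ x, ‖Torus.partialDeriv i (f s) x‖ ≤ C :=
    eventually_all.2 fun i => eventually_norm_le (hf.partialDeriv hS i) hK hKS
  have h2 : ∀ᶠ C in atTop, ∀ i j : Fin 3, ∀ s ∈ K, ∀ x,
      ‖Torus.partialDeriv i (Torus.partialDeriv j (f s)) x‖ ≤ C :=
    eventually_all.2 fun i => eventually_all.2 fun j =>
      eventually_norm_le ((hf.partialDeriv hS j).partialDeriv hS i) hK hKS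
  have h3 : ∀ᶠ C in atTop, ∀ i j k : Fin 3, ∀ s ∈ K, ∀ x,
      ‖Torus.partialDeriv i (Torus.partialDeriv j (Torus.partialDeriv k (f s))) x‖ ≤ C :=
    eventually_all.2 fun i => eventually_all.2 fun j => eventually_all.2 fun k =>
      eventually_norm_le (((hf.partialDeriv hS k).partialDeriv hS j).partialDeriv hS i) hK hKS
  filter_upwards [h0, h1, h2, h3] with C h0 h1 h2 h3 s hs x
  exact ⟨h0 s hs x, fun i j k => ⟨h1 i s hs x, h2 i j s hs x, h3 i j k s hs x⟩⟩

/-- **Finite size of a classical hard-sphere Euler solution on compact time intervals.** For a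
classical solution `(ρ, u, θ)` of the hard-sphere compressible Euler system on `[0, T) × 𝕋³`
(`IsHardSphereEulerSolution σ T ρ u θ`) and every `t < T` there is one level `M > 0` such that on
`[0, t] × 𝕋³`: `ρ ≤ M`, `θ ≤ M`, `θ ≥ M⁻¹`, `‖u‖ ≤ M`, and all spatial partial derivatives of
`ρ, u, θ` of orders `1, 2, 3` are bounded by `M` (continuity of the derivatives of a jointly smooth
field and of `θ⁻¹`, compactness of `[0, t] × 𝕋³`). For `t < 0` the interval is empty. [folklore] -/
theorem stub_finiteSize :
    ∀ (σ T : ℝ) (ρ θ : ℝ → T3 → ℝ) (u : ℝ → T3 → V3), IsHardSphereEulerSolution σ T ρ u θ →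
      ∀ t : ℝ, t < T → ∃ M : ℝ, 0 < M ∧ ∀ s ∈ Set.Icc 0 t, ∀ x, ρ s x ≤ M ∧ θ s x ≤ M ∧
        M⁻¹ ≤ θ s x ∧ ‖u s x‖ ≤ M ∧ ∀ i j k : Fin 3, |Torus.partialDeriv i (ρ s) x| ≤ M ∧
        ‖Torus.partialDeriv i (u s) x‖ ≤ M ∧ |Torus.partialDeriv i (θ s) x| ≤ M ∧
        |Torus.partialDeriv i (Torus.partialDeriv j (ρ s)) x| ≤ M ∧
        ‖Torus.partialDeriv i (Torus.partialDeriv j (u s)) x‖ ≤ M ∧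
        |Torus.partialDeriv i (Torus.partialDeriv j (θ s)) x| ≤ M ∧
        |Torus.partialDeriv i (Torus.partialDeriv j (Torus.partialDeriv k (ρ s))) x| ≤ M ∧
        ‖Torus.partialDeriv i (Torus.partialDeriv j (Torus.partialDeriv k (u s))) x‖ ≤ M ∧
        |Torus.partialDeriv i (Torus.partialDeriv j (Torus.partialDeriv k (θ s))) x| ≤ M := by
  intro σ T ρ θ u hsol t ht
  -- the compact time set `[0, t]` inside the time set `[0, T)` of unique differentiability
  have hKS : Icc 0 t ⊆ Ico 0 T := Icc_subset_Ico_right ht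
  have hK : IsCompact (Icc (0 : ℝ) t) := isCompact_Icc
  have hS : UniqueDiffOn ℝ (Ico (0 : ℝ) T) := uniqueDiffOn_Ico 0 T
  -- `θ⁻¹` is jointly smooth (`θ > 0` on `[0, T)`)
  have hθinv : Torus.IsSmoothSpaceTimeOn (Ico 0 T) (fun s x => (θ s x)⁻¹) :=
    hsol.smooth_temperature.comp_contDiffOn (contDiffOn_inv ℝ) fun s hs x =>
      mem_compl_singleton_iff.2 (hsol.temperature_pos s hs x).ne'
  -- all bounds hold for every sufficiently large constant; pick one positive such constant
  obtain ⟨M, hM, hρb, hub, hθb, hθib⟩ := ((eventually_gt_atTop (0 : ℝ)).and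
    ((eventually_derivs_le hsol.smooth_density hS hK hKS).and
    ((eventually_derivs_le hsol.smooth_velocity hS hK hKS).and
    ((eventually_derivs_le hsol.smooth_temperature hS hK hKS).and
    (eventually_norm_le hθinv hK hKS))))).exists
  refine ⟨M, hM, fun s hs x => ?_⟩
  obtain ⟨hρ0, hρd⟩ := hρb s hs x
  obtain ⟨hu0, hud⟩ := hub s hs x
  obtain ⟨hθ0, hθd⟩ := hθb s hs x
  have hθpos : 0 < θ s x := hsol.temperature_pos s (hKS hs) x
  refine ⟨(Real.le_norm_self _).trans hρ0, (Real.le_norm_self _).trans hθ0,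
    inv_le_of_inv_le₀ hθpos ((Real.le_norm_self _).trans (hθib s hs x)), hu0, fun i j k => ?_⟩
  obtain ⟨h1, h2, h3⟩ := hρd i j k
  obtain ⟨h1', h2', h3'⟩ := hud i j k
  obtain ⟨h1'', h2'', h3''⟩ := hθd i j k
  simp only [Real.norm_eq_abs] at h1 h2 h3 h1'' h2'' h3''
  exact ⟨h1, h1', h1'', h2, h2', h2'', h3, h3', h3''⟩

end Summit.AtomisticToContinuum.HydrodynamicLimit.Theorems.RestartPrinciple

end
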